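import Literature.MathematicalPhysics.QuantumFieldTheory.Balaban1983to89.B6Prop27OneScaleTorus
import HarnessLib

/-!
# NE7LinOneStepAbelianSup — the regularity road's `L^∞` mechanism IN KERNEL IN THE ABELIAN FLAT MODEL: the linear constrained minimiser
# `H_k` (Bałaban's Landau-gauge minimiser (1.63)∕(1.103) of `½⟨∂A,∂A⟩` on `{Q_kA = B}`) maps `sup|B|` to `sup|H_kB|`, `sup|∂_νH_kB|` and
# `sup|curl H_kB|` with constants depending on `d` ONLY — uniformly in the level `n = L^k` and in the volume

Cell `pub-balaban`, rung (B)+1 sub-cell t4, lineage `b2b-balaban-t4-ne7-p1`, generation 64 (CRUX PROVER NE7 #1, ruling e34b3e0c (2)); hunt (h8)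
«REGULARITY ROAD», step (h8-iii′) (memo `t4/b2b-balaban-t4-ne7-p1-g64/HUNT-H8-REGULARITY-ROAD.md` §3–§4).  After gen 64's files 1–4 route 1's
(A)-bill at data with curvature reads X-A4 ∧ ONE-STEP, ONE-STEP = [Balaban1985Variational] Thm 1 given an admissible competitor; its core (memo
§2) is a LEVEL-UNIFORM `L^∞ → L^∞` bound for the inverse of the linearised constrained operator — the bound no `ℓ²` argument gives.  In the
ABELIAN FLAT model (`U = 1`, `m² = 0`, torus `T_η → T₁`, `η = 1∕n`) that operator is the typed `H_k` of the cell `lit-balaban`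
(`B5Hk163Torus.HkOp n M`), whose kernel and derivative kernel DECAY EXPONENTIALLY, uniformly in `n` and in the period vector `M`
(`B5Hk163Torus.norm_HkOp_le`, `B5Hk163TorusHolderDecay.norm_dker_bpt_le` — [Balaban1984PropagatorsII] Cor. 2.8 (2.151), kernel-proved there as
`B6MainResultsOneLevel.cor28Printed_block`).  THIS FILE sums those kernels against a bounded datum with the volume-uniform torus sum
`B5Hk163TorusHolderRate.sum_exp_torusSupNorm_sub_rep_le`:
* **`norm_HkOp_mulVec_le_sup`** — `|(H_kB)_μ(x)| ≤ C_H(d)·sup|B|` at EVERY fine point `x`;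
* **`norm_fdiff_HkOp_mulVec_le_sup`** — `|∂_ν(H_kB)_μ(x)| ≤ C_D(d)·sup|B|` ([Dimock, arXiv:1512.04373, Lemma 9 (237)] shape «|∂H_k f| ≤ C‖f‖_∞»);
* **`norm_curl_HkOp_mulVec_le_sup`** — `|∂_μ(H_kB)_ν(x) − ∂_ν(H_kB)_μ(x)| ≤ 2C_D(d)·sup|B|`: THE CURVATURE OF THE LINEAR CONSTRAINED MINIMISER IS
  BOUNDED POINTWISE BY THE SUP OF THE DATUM, UNIFORMLY IN THE LEVEL AND THE VOLUME — the abelian flat image of the «even spreading» that the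
  induction `NE7InteriorInduction.interior_exists_all_levels` asks of ONE-STEP (memo §2 (a)).
`C_H = MG163(d+1)·periodConst(κ₁₆₃(d+1),d)·(d+1)·K_{d+1}(κ₁₆₃(d+1)∕(d+1))`, `C_D` the same with `MD163` (constants of the lit-balaban lineage, dimension-only).
HONEST FRAMING (page 1): ABELIAN, FLAT (`U = 1`), LINEAR — NOT the non-abelian ONE-STEP (B11 Sects. B–F at a curved background, [PropagatorsII]
with `U ≠ 1`), NOT NE7; a kernel certificate that the `L^∞` mechanism of the regularity road holds in the model where the print starts.  0 def,
0 sorry.  Continuum YM on T⁴ ⇐ BetaPertH ∧ nine spine estimates (0/9 proved); BetaPertH ⇐ (D1) ∧ (D4) ∧ CAP+tail; G-an2-4 gates asym, D1 and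
NE2/3/4; NOT infinite volume, NOT mass gap, NOT Clay.
-/

set_option autoImplicit false

noncomputable section

open Finset Matrix

namespace Summit.QuantumFields.BalabanUV.T4Continuum.NE7LinOneStepAbelianSup

open Literature.MathematicalPhysics.QuantumFieldTheory.Balaban1983to89
open B4TorusKernel (periodConst)
open B4TorusKernel.MultiPeriod (torusSupNorm)
open B4Sect5Proof (latticeConst latticeConst_nonneg)
open B5Prop11Plancherel (Tor fine fdiff)
open B5Block118 (bpt)
open B5Blocks16 (blockOf)
open B6LowerBound2153Torus (toT rep toT_rep)
open B5Hk163Strip (kappa163 kappa163_pos)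
open B5Kernel166Decay (periodConst_pos)
open B5Hk163Decay (MG163 MG163_nonneg)
open B5Hk163Torus (HkOp norm_HkOp_mulVec_le)
open B5Hk163TorusHolder (dker fdiff_HkOp_mulVec)
open B5Hk163TorusHolderDecay (MD163 CdecD CdecD_nonneg norm_dker_bpt_le)
open B5Hk163TorusHolderRate (sum_exp_torusSupNorm_sub_rep_le)
open Beta.FluctuationProjection (digitOf bpt_blockOf_digitOf)

variable {d : ℕ} (n : ℕ) [NeZero n] (M : Fin (d + 1) → ℕ) [hM : ∀ μ, NeZero (M μ)]

/-- The volume-uniform weighted sum of a bounded datum: `Σ_{y,λ} e^{−δ|x′ − rep y|_{T,∞}}·|B_λ(y)| ≤ (d+1)·K_{d+1}(δ)·b` for `|B| ≤ b`,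
`δ = κ₁₆₃(d+1)∕(d+1)` (`sum_exp_torusSupNorm_sub_rep_le`). [folklore] -/
theorem weighted_sum_le (B : Tor M × Fin (d + 1) → ℂ) {b : ℝ} (hB : ∀ y lam, ‖B (y, lam)‖ ≤ b) (x' : Fin (d + 1) → ℤ) :
    ∑ y : Tor M, ∑ lam : Fin (d + 1),
        Real.exp (-(kappa163 (d + 1) / (d + 1) * torusSupNorm M (x' - rep M y))) * ‖B (y, lam)‖
      ≤ ((d : ℝ) + 1) * latticeConst (d + 1) (kappa163 (d + 1) / (d + 1)) * b := by
  have hδ : 0 < kappa163 (d + 1) / (d + 1) := div_pos (kappa163_pos (d + 1)) (by positivity)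
  have hb : 0 ≤ b := (norm_nonneg _).trans (hB 0 0)
  have hK := sum_exp_torusSupNorm_sub_rep_le M hδ x'
  calc ∑ y : Tor M, ∑ lam : Fin (d + 1),
        Real.exp (-(kappa163 (d + 1) / (d + 1) * torusSupNorm M (x' - rep M y))) * ‖B (y, lam)‖
      ≤ ∑ y : Tor M, ∑ _lam : Fin (d + 1),
          Real.exp (-(kappa163 (d + 1) / (d + 1) * torusSupNorm M (x' - rep M y))) * b := by
        refine Finset.sum_le_sum fun y _ => Finset.sum_le_sum fun lam _ => ?_
        exact mul_le_mul_of_nonneg_left (hB y lam) (Real.exp_pos _).le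
    _ = ((d : ℝ) + 1) * b * ∑ y : Tor M, Real.exp (-(kappa163 (d + 1) / (d + 1) * torusSupNorm M (x' - rep M y))) := by
        simp only [Finset.sum_const, Finset.card_univ, Fintype.card_fin, nsmul_eq_mul]
        rw [Finset.mul_sum]
        refine Finset.sum_congr rfl fun y _ => ?_
        push_cast; ring
    _ ≤ ((d : ℝ) + 1) * b * latticeConst (d + 1) (kappa163 (d + 1) / (d + 1)) :=
        mul_le_mul_of_nonneg_left hK (by positivity)
    _ = ((d : ℝ) + 1) * latticeConst (d + 1) (kappa163 (d + 1) / (d + 1)) * b := by ring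

/-- **`sup|H_kB| ≤ C_H(d)·sup|B|`, UNIFORMLY IN THE LEVEL `n = L^k` AND THE VOLUME**: at every fine point `x ∈ T_η` and every direction `μ`,
`|(H_kB)_μ(x)| ≤ MG163(d+1)·periodConst(κ₁₆₃(d+1),d)·((d+1)·K_{d+1}(κ₁₆₃(d+1)∕(d+1)))·sup|B|` (the decaying kernel of `B5Hk163Torus.norm_HkOp_le` summed;
[Balaban1984PropagatorsII] Cor. 2.8 (2.151) first entry, TYPE; abelian, `U = 1`). [folklore] -/
theorem norm_HkOp_mulVec_le_sup (B : Tor M × Fin (d + 1) → ℂ) {b : ℝ} (hB : ∀ y lam, ‖B (y, lam)‖ ≤ b)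
    (x : Tor (fine n M)) (μ : Fin (d + 1)) :
    ‖(HkOp n M *ᵥ B) (x, μ)‖
      ≤ MG163 (d + 1) * periodConst (kappa163 (d + 1)) d
          * (((d : ℝ) + 1) * latticeConst (d + 1) (kappa163 (d + 1) / (d + 1))) * b := by
  have e : bpt n M (toT M (rep M (blockOf n M x))) (digitOf n M x) = x := by rw [toT_rep, bpt_blockOf_digitOf]
  have h := norm_HkOp_mulVec_le n M B μ (digitOf n M x) (rep M (blockOf n M x)) (rep M) (toT_rep M)
  rw [e] at h
  have hW := weighted_sum_le M B hB (rep M (blockOf n M x))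
  have hC : 0 ≤ MG163 (d + 1) * periodConst (kappa163 (d + 1)) d :=
    mul_nonneg (MG163_nonneg _) (periodConst_pos (kappa163_pos _) d).le
  calc ‖(HkOp n M *ᵥ B) (x, μ)‖
      ≤ MG163 (d + 1) * periodConst (kappa163 (d + 1)) d *
          ∑ y : Tor M, ∑ lam : Fin (d + 1),
            Real.exp (-(kappa163 (d + 1) / (d + 1) * torusSupNorm M (rep M (blockOf n M x) - rep M y))) * ‖B (y, lam)‖ := h
    _ ≤ MG163 (d + 1) * periodConst (kappa163 (d + 1)) d
          * (((d : ℝ) + 1) * latticeConst (d + 1) (kappa163 (d + 1) / (d + 1)) * b) := mul_le_mul_of_nonneg_left hW hC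
    _ = _ := by ring

/-- **`sup|∂_νH_kB| ≤ C_D(d)·sup|B|`, UNIFORMLY IN THE LEVEL AND THE VOLUME**: at every fine point `x` and all `μ, ν`,
`|∂_ν(H_kB)_μ(x)| ≤ CdecD(d)·((d+1)·K_{d+1}(κ₁₆₃(d+1)∕(d+1)))·sup|B|`, `CdecD d = MD163(d+1)·periodConst(κ₁₆₃(d+1),d)`, `∂_ν = η⁻¹ ×` the forward
difference (the decaying derivative kernel `B5Hk163TorusHolderDecay.norm_dker_bpt_le` summed; [Balaban1984PropagatorsII] Cor. 2.8 (2.151) second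
entry ∕ [Dimock 2015, arXiv:1512.04373, Lemma 9 (237)] «|∂H_k f| ≤ C‖f‖_∞», TYPE; abelian, `U = 1`). [folklore] -/
theorem norm_fdiff_HkOp_mulVec_le_sup (B : Tor M × Fin (d + 1) → ℂ) {b : ℝ} (hB : ∀ y lam, ‖B (y, lam)‖ ≤ b)
    (x : Tor (fine n M)) (μ ν : Fin (d + 1)) :
    ‖(fdiff (fine n M) (n : ℂ) ν *ᵥ (HkOp n M *ᵥ B)) (x, μ)‖
      ≤ CdecD d * (((d : ℝ) + 1) * latticeConst (d + 1) (kappa163 (d + 1) / (d + 1))) * b := by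
  have e : bpt n M (toT M (rep M (blockOf n M x))) (digitOf n M x) = x := by rw [toT_rep, bpt_blockOf_digitOf]
  -- the decaying kernel, pointwise
  have hker : ∀ (y : Tor M) (lam : Fin (d + 1)), ‖dker n M μ lam ν x y‖
      ≤ CdecD d * Real.exp (-(kappa163 (d + 1) / (d + 1) * torusSupNorm M (rep M (blockOf n M x) - rep M y))) := by
    intro y lam
    have h2 := norm_dker_bpt_le n M μ lam ν (digitOf n M x) (rep M (blockOf n M x)) (rep M y)
    rw [e, toT_rep] at h2
    exact h2
  have hW := weighted_sum_le M B hB (rep M (blockOf n M x))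
  calc ‖(fdiff (fine n M) (n : ℂ) ν *ᵥ (HkOp n M *ᵥ B)) (x, μ)‖
      ≤ ∑ y : Tor M, ∑ lam : Fin (d + 1), ‖dker n M μ lam ν x y‖ * ‖B (y, lam)‖ := by
        rw [fdiff_HkOp_mulVec]
        refine (norm_sum_le _ _).trans (Finset.sum_le_sum fun y _ => ?_)
        refine (norm_sum_le _ _).trans (Finset.sum_le_sum fun lam _ => ?_)
        rw [norm_mul]
    _ ≤ ∑ y : Tor M, ∑ lam : Fin (d + 1),
          CdecD d * Real.exp (-(kappa163 (d + 1) / (d + 1) * torusSupNorm M (rep M (blockOf n M x) - rep M y)))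
            * ‖B (y, lam)‖ :=
        Finset.sum_le_sum fun y _ => Finset.sum_le_sum fun lam _ => mul_le_mul_of_nonneg_right (hker y lam) (norm_nonneg _)
    _ = CdecD d * ∑ y : Tor M, ∑ lam : Fin (d + 1),
          Real.exp (-(kappa163 (d + 1) / (d + 1) * torusSupNorm M (rep M (blockOf n M x) - rep M y))) * ‖B (y, lam)‖ := by
        rw [Finset.mul_sum]
        refine Finset.sum_congr rfl fun y _ => ?_
        rw [Finset.mul_sum]
        refine Finset.sum_congr rfl fun lam _ => ?_
        ring
    _ ≤ CdecD d * (((d : ℝ) + 1) * latticeConst (d + 1) (kappa163 (d + 1) / (d + 1)) * b) :=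
        mul_le_mul_of_nonneg_left hW CdecD_nonneg
    _ = _ := by ring

/-- **THE CURVATURE OF THE LINEAR CONSTRAINED MINIMISER IS BOUNDED POINTWISE BY THE SUP OF THE DATUM, UNIFORMLY IN THE LEVEL AND THE VOLUME**
(abelian, `U = 1`): `|∂_μ(H_kB)_ν(x) − ∂_ν(H_kB)_μ(x)| ≤ 2·CdecD(d)·((d+1)·K_{d+1}(κ₁₆₃(d+1)∕(d+1)))·sup|B|` at every fine point `x` — the abelian
flat image of the `L^∞` «even spreading» that ONE-STEP asks (memo §2 (a)); the non-abelian, curved-background statement is B11 Sects. B–F,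
NOT this. [folklore] -/
theorem norm_curl_HkOp_mulVec_le_sup (B : Tor M × Fin (d + 1) → ℂ) {b : ℝ} (hB : ∀ y lam, ‖B (y, lam)‖ ≤ b)
    (x : Tor (fine n M)) (μ ν : Fin (d + 1)) :
    ‖(fdiff (fine n M) (n : ℂ) μ *ᵥ (HkOp n M *ᵥ B)) (x, ν) - (fdiff (fine n M) (n : ℂ) ν *ᵥ (HkOp n M *ᵥ B)) (x, μ)‖
      ≤ 2 * (CdecD d * (((d : ℝ) + 1) * latticeConst (d + 1) (kappa163 (d + 1) / (d + 1))) * b) := by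
  have h1 := norm_fdiff_HkOp_mulVec_le_sup n M B hB x ν μ
  have h2 := norm_fdiff_HkOp_mulVec_le_sup n M B hB x μ ν
  calc ‖(fdiff (fine n M) (n : ℂ) μ *ᵥ (HkOp n M *ᵥ B)) (x, ν) - (fdiff (fine n M) (n : ℂ) ν *ᵥ (HkOp n M *ᵥ B)) (x, μ)‖
      ≤ ‖(fdiff (fine n M) (n : ℂ) μ *ᵥ (HkOp n M *ᵥ B)) (x, ν)‖ + ‖(fdiff (fine n M) (n : ℂ) ν *ᵥ (HkOp n M *ᵥ B)) (x, μ)‖ :=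
        norm_sub_le _ _
    _ ≤ _ := by linarith

end Summit.QuantumFields.BalabanUV.T4Continuum.NE7LinOneStepAbelianSup
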